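import Literature.AlgebraicGeometry.ShimuraVarieties.UnitaryShimuraCanonicalModelUnique
import Literature.AlgebraicGeometry.ShimuraVarieties.UnitaryShimuraComplexRecordSystemIso
import Literature.AlgebraicGeometry.ShimuraVarieties.UnitaryShimuraRecordDescent
import HarnessLib

/-!
# Two Deligne record systems at one datum have isomorphic model towers (modulo the printed uniqueness, Milne Thm. 13.7)

Topic `AlgebraicGeometry/ShimuraVarieties`; namespace `Literature.AlgebraicGeometry.ShimuraVarieties`, grouping sub-namespace
`UnitaryCanonicalModel` (the object of `UnitaryShimuraCanonicalModel`).  THEOREMS ONLY, CONDITIONAL on the named fact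
`canonicalModel_unique_printed` ([Milne2005ShimuraVarieties] Thm. 13.7 (a), `UnitaryShimuraCanonicalModelUnique`) taken as a HYPOTHESIS
`hU`; no definition, no instance, no new named fact; nothing asserted about any cell's objects.

[Milne2005ShimuraVarieties] Thm. 13.7 (a) p. 119 «A canonical model of `Sh_K(G,X)` (if it exists) is unique up to a unique isomorphism»,
read on the tree's packaging of Deligne's models as `RecordSystem L H τ T hT K₀` ([Deligne1979ShimuraVarieties] 2.2.5): the named fact
`canonicalModel_unique_printed` identifies two CANONICAL `L`-forms `(M, e)`, `(M′, e′)` of ONE complex record system `Sc`; two record systems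
`R`, `R′` at the same datum are such forms of `Sc := R′.complexRecordSystem` — `R′` through `Iso.refl` (✔ `RecordSystem.descent_self`), `R`
through ✔ `RecordSystem.exists_iso_complexRecordSystem R Sc` (complex uniqueness, [Deligne1979ShimuraVarieties] 2.1.2 [Borel]) and its
reciprocity (F3).  Hence:

* **`RecordSystem.exists_iso_of_unique`** — `∃ φ : R.M ≅ R′.M` carrying `R.pts_K⁻¹ [z, aK]` to `R′.pts_K⁻¹ [z, aK]` at every level (the
  form compatibility `(φ_K ⊗ ℂ) ≫ 𝟙 = e_K` read on points through the naturality of `AlgPoints.baseChangeEquiv`).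

Consumers: the off-place half of the H21 cell's binder `hLiu418` (the two CHOSEN records `recordOf h V _` at `(V.Hm, ι₁)` re-read at the
conjugate embedding, and `recordOf h V₀ _`), after the same-models re-readings of the embedding / frame.  HC_CM is not mentioned and not implied.

## References
* [Milne2005ShimuraVarieties] J. S. Milne, *Introduction to Shimura varieties* (2005; rev. 2017): Thm. 13.7 (a) p. 119, Prop. 13.1 p. 117,
  Def. 12.8 (62) p. 114.
* [Deligne1979ShimuraVarieties] P. Deligne, *Variétés de Shimura*, PSPM XXXIII.2 (1979): 2.1.2, 2.2.5–2.2.6, 2.7.12.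
-/

set_option autoImplicit false

noncomputable section

open Function MulAction Topology NumberField IsDedekindDomain CategoryTheory CategoryTheory.Limits Matrix AlgebraicGeometry
open scoped Matrix ComplexOrder
open Literature.AlgebraicGeometry.Motives
open Literature.NumberTheory.Automorphic Literature.NumberTheory.Automorphic.UnitaryGroup
open Literature.NumberTheory.Automorphic.Liu2021.AppendixC (C5.OpenCompactSubgroup C5.SmallLevel)
open Literature.Geometry.ComplexHyperbolic Literature.Geometry.ComplexHyperbolic.BallModel

namespace Literature.AlgebraicGeometry.ShimuraVarieties

namespace UnitaryCanonicalModel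

variable {L : Type} [Field L] [NumberField L] [IsCMField L] {H : Matrix (Fin 3) (Fin 3) L}
  {τ : L →+* ℂ} {T : GL (Fin 3) ℂ} {hT : formCongr (starRingEnd ℂ) T (H.map τ) = BallModel.J}
  {K₀ : C5.OpenCompactSubgroup ↥(finAdelic (↥(maximalRealSubfield L)) L (IsCMField.complexConj L) 3 H)}

omit [NumberField L] [IsCMField L] in
/-- Naturality of `X_τ(ℂ) → X(ℂ)` (`AlgPoints.baseChangeEquiv`, inverse direction) in the `L`-scheme `X` (as in
`UnitaryShimuraComplexRecordSystem` / `UnitaryShimuraRecordDescent`, where it is private). [folklore] -/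
private theorem baseChangeEquiv_symm_map'' {X Y : SchemeOver L} (f : X ⟶ Y)
    (u : ComplexPoints ((Motives.baseChangeHom τ).obj X)) :
    (letI : Algebra L ℂ := τ.toAlgebra
     (AlgPoints.baseChangeEquiv τ Y).symm (AlgPoints.map ((Motives.baseChangeHom τ).map f) u) =
      AlgPoints.map f ((AlgPoints.baseChangeEquiv τ X).symm u)) := by
  letI : Algebra L ℂ := τ.toAlgebra
  apply Over.OverMorphism.ext
  rw [AlgPoints.baseChangeEquiv_symm_apply_left, AlgPoints.map_apply, Over.comp_left,
    AlgPoints.map_apply, Over.comp_left, AlgPoints.baseChangeEquiv_symm_apply_left]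
  simp only [Category.assoc, Motives.baseChangeHom_map_left_comp_fst]
  exact (Category.assoc _ _ _).symm

set_option maxHeartbeats 400000 in
/-- **Two record systems at ONE datum have isomorphic model towers, compatibly with their points** (modulo the printed uniqueness
`canonicalModel_unique_printed`, taken as the hypothesis `hU`; the other hypotheses are the datum's standing ones — `H` positive definite
off the place of `τ`, anisotropic, `K₀` with torsion-free conjugate arithmetic levels — copied from the named fact): for
`R R′ : RecordSystem L H τ T hT K₀` there is `φ : R.M ≅ R′.M` (a natural isomorphism of the functors of models on the levels `K ≤ K₀`)
with `φ_K (R.pts_K⁻¹ [z, aK]) = R′.pts_K⁻¹ [z, aK]` on complex points.  Proof: both `(R.M, e)` (`e` from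
`RecordSystem.exists_iso_complexRecordSystem R R′_ℂ`, reciprocity `R.recip`) and `(R′.M, Iso.refl)` (`RecordSystem.descent_self`) are canonical
descents of `Sc := R′.complexRecordSystem`; `hU` gives `φ` with `(φ_K ⊗ ℂ) ≫ 𝟙 = e_K`, read on points by the naturality of
`AlgPoints.baseChangeEquiv`. [cite: Milne2005ShimuraVarieties, Thm. 13.7 (a) p. 119 and Prop. 13.1 p. 117]
[cite: Deligne1979ShimuraVarieties, 2.2.5–2.2.6 (PDF p. 29 of Milne's translation)] -/
theorem RecordSystem.exists_iso_of_unique (hU : canonicalModel_unique_printed)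
    (hpos : ∀ τ' : L →+* ℂ, InfinitePlace.mk τ' ≠ InfinitePlace.mk τ → (H.map τ').PosDef)
    (hanis : ∀ v : Fin 3 → L, hermForm (cmConjRingHom L) H v v = 0 → v = 0)
    (htf : ∀ g : finAdelic (↥(maximalRealSubfield L)) L (IsCMField.complexConj L) 3 H,
      ∀ γ ∈ arithmeticLevel (↥(maximalRealSubfield L)) L (IsCMField.complexConj L) 3 H
        (K₀.1.map (MulAut.conj g).toMonoidHom), IsOfFinOrder γ → γ = 1)
    (R R' : RecordSystem L H τ T hT K₀) :
    ∃ φ : R.M ≅ R'.M,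
      letI : Algebra L ℂ := τ.toAlgebra
      ∀ (K : C5.SmallLevel K₀) (P : ShimuraSet L H τ T hT K.1.1),
        AlgPoints.map (φ.hom.app K) ((R.pts K).symm P) = (R'.pts K).symm P := by
  letI : Algebra L ℂ := τ.toAlgebra
  obtain ⟨e, he⟩ := R.exists_iso_complexRecordSystem R'.complexRecordSystem
  have hc : IsCanonicalDescentAt R'.complexRecordSystem R.M e := by
    intro K σ s hs v₃ x hx d hd a
    rw [he, he]
    exact R.recip K σ s hs v₃ x hx d hd a
  have hc' : IsCanonicalDescentAt R'.complexRecordSystem R'.M (Iso.refl _) := R'.descent_self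
  obtain ⟨φ, hφ, -⟩ := hU L H τ T hT hpos hanis K₀ htf R'.complexRecordSystem R.M R'.M R.smooth R.projective
    R'.smooth R'.projective e (Iso.refl _) hc hc'
  refine ⟨φ, fun K P => ?_⟩
  -- the form compatibility `(φ_K ⊗ ℂ) ≫ 𝟙 = e_K`
  have hφK : e.hom.app K = (Motives.baseChangeHom τ).map (φ.hom.app K) :=
    ((Category.comp_id _).symm.trans (hφ K)).symm
  -- `(φ_K ⊗ ℂ) ∘ e_K⁻¹ = 1` on complex points
  have h2 : ∀ Q : ComplexPoints (R'.complexRecordSystem.Mc.obj K),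
      AlgPoints.map ((Motives.baseChangeHom τ).map (φ.hom.app K)) (AlgPoints.map (e.inv.app K) Q) = Q := fun Q => by
    have h := AlgPoints.map_comp_apply (e.inv.app K) (e.hom.app K) Q
    rw [Iso.inv_hom_id_app, AlgPoints.map_id_apply, hφK] at h
    exact h.symm
  -- read on points: `φ_K (R.pts⁻¹ P) = φ_K ((M_K(ℂ) ≃ (M_K)_τ(ℂ))⁻¹ (e_K⁻¹ (Sc.pts⁻¹ P))) = (M′_K(ℂ) ≃ (M′_K)_τ(ℂ))⁻¹ ((φ_K ⊗ ℂ) (e_K⁻¹ (Sc.pts⁻¹ P)))`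
  calc AlgPoints.map (φ.hom.app K) ((R.pts K).symm P)
      = AlgPoints.map (φ.hom.app K) ((AlgPoints.baseChangeEquiv τ (R.M.obj K)).symm
          (AlgPoints.map (e.inv.app K) ((R'.complexRecordSystem.pts K).symm P))) := by rw [he K P]
    _ = (AlgPoints.baseChangeEquiv τ (R'.M.obj K)).symm
          (AlgPoints.map ((Motives.baseChangeHom τ).map (φ.hom.app K))
            (AlgPoints.map (e.inv.app K) ((R'.complexRecordSystem.pts K).symm P))) :=
        (baseChangeEquiv_symm_map'' (φ.hom.app K) _).symm
    _ = (AlgPoints.baseChangeEquiv τ (R'.M.obj K)).symm ((R'.complexRecordSystem.pts K).symm P) :=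
        congrArg (AlgPoints.baseChangeEquiv τ (R'.M.obj K)).symm (h2 _)
    _ = (R'.pts K).symm P := (AlgPoints.baseChangeEquiv τ (R'.M.obj K)).symm_apply_apply _

end UnitaryCanonicalModel

end Literature.AlgebraicGeometry.ShimuraVarieties

end
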